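import Summits.QuantumFields.QCD.Theses.QuarkMassMonotone
import HarnessLib.Audit

/-!
# Birth skeleton (BC3) for the crux `ChirallyAnchoredQCDThree` (item stmt-QuantumFields-17305)

Route `QuarkMassMonotone` (sub-problem QCD), crux decl
`Summit.QuantumFields.QCD.Theses.QuarkMassMonotone.ChirallyAnchoredQCDThree` (rev 5, rank 3; the chirally anchored
`N_f = 3` SOCKET, re-typed 2026-08-16 after p117723):

  `∃ reg : QCDRegularisation 3, reg.HasMassScaling ∧ reg.IsChiralAtZero ∧
     (∀ m > 0, ∃ m⋆, 0 < m⋆ ≤ m ∧ RAY-CERTIFICATE(reg, m⋆) ∧ ∃ Δ⋆ > 0, (reg.scheme m⋆ 0 0).HasLatticeMassGap Δ⋆) ∧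
     (∀ m > 0, ∃ z shift T, IsQCDAlong (reg.scheme m z shift) T ∧ T.IsNontrivial glue ∧ T.IsNonGaussian glue ∧
        (∀ f ≠ g, T.IsNontrivial (pseudoRe f g)) ∧ ∃ Δ > 0, T.HasMassGap Δ)`.

Registered by the skeleton-registrar seat `planner-skel-stmt-QuantumFields-17305-0` (route re-audit bin REPAIRABLE,
2026-08-17) as `Cruxes/ChirallyAnchoredQCDThree/Lines/birth.lean`.  It is the route-level BIRTH CERTIFICATE of the crux
(≥ 2 named stubs, a kernel-checked composition concluding the crux BY NAME, `sorry` only inside `stub_*`), deliberately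
LINE-NEUTRAL: it cuts the socket along the route header's OWN two-layer plan for this node —
"ChirallyAnchoredQCD_N would split as DiagonalLatticeAnchors_N (lattice only: reg with HasMassScaling ∧ IsChiralAtZero,
certified gapped degenerate anchors η_j ↓ 0, plus an intrinsic pin of m_crit) → ContinuumBodyOfPinned_N (for every so
pinned regularisation: OS data, non-triviality, non-decoupling, continuum gap for all m > 0 along one sequence); the
chiral clause may later be factored through the shared crux EulerDescent.ChiralCornerSoftness (pinned ⇒ IsChiralAtZero)"
— into ONE constructive lattice piece and TWO ∀-laws over honestly pinned regularisations, all typed over the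
Statement's own vocabulary (`QCDRegularisation`, `HasMassScaling`, `HasAsymptoticScaling`, `HasLatticeMassGap`,
`IsChiralAtZero`, `IsQCDAlong`, `IsNontrivial`, `IsNonGaussian`, `HasMassGap`, `QCDLatticeObservable`,
`qcdLatticeConnectedCorr`) plus the INTRINSIC-CORNER PIN typed verbatim as in `EulerDescent.RayDescent /
ChiralCornerSoftness` (stmt-QuantumFields-16900/16902), so that the chiral law below is literally the `N_f = 3` instance of
that shared crux:

* `stub_diagonalLatticeAnchors : Stmt.stub_diagonalLatticeAnchors` (open-problem; the header's DiagonalLatticeAnchors₃,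
  GAPPED side only) — there is a regularisation `reg : QCDRegularisation 3` with leading-log mass scaling which is
  HONESTLY PINNED (`HonestlyPinned`: eventually in `k` some `mc k` is the least upper bound of the degenerate bare Wilson
  masses at which lattice QCD at coupling `β_k` is not massive, `(reg.mcrit k − mc k)·Z_m(k)/a_k → 0`, two-loop
  asymptotic scaling of `β_k` against `a_k`, `reg.mcrit k > −1` eventually) and carries DIAGONAL CERTIFIED GAPPED
  ANCHORS: one sequence `η_j > 0`, `η_j → 0`, such that every degenerate tuple `(η_j, η_j, η_j)` has the physical-branch
  ray certificate (fixed-`k` clustering along the whole bare ray above it, eventually in `k`) and a uniform lattice gap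
  `Δ⋆_j > 0` in physical units.  No chiral clause, no continuum clause.
* `stub_chiralSoftness : Stmt.stub_chiralSoftness` (open-problem; the Goldstone INPUT, a no-gap law — the `N_f = 3`
  instance of `EulerDescent.ChiralCornerSoftness`, one proof serves both) — EVERY honestly pinned `N_f = 3`
  regularisation with leading-log mass scaling is chiral at zero: `reg.IsChiralAtZero` (for every `ε > 0` some positive
  tuple has no uniform lattice gap `ε`; Goldstone law `m_π² ∝ m_q` if chiral symmetry breaks, anomaly matching otherwise).
* `stub_continuumBodyOfPinned : Stmt.stub_continuumBodyOfPinned` (open-problem; the header's ContinuumBodyOfPinned₃,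
  the "arzela-ascoli-in-the-quark-mass" half) — for EVERY honestly pinned `N_f = 3` regularisation with leading-log mass
  scaling carrying diagonal certified gapped anchors there is a SUBSEQUENCE of steps `φ` (strictly increasing) along
  which, for EVERY positive tuple `m`, species renormalisations `z, shift` and OS data `T` exist with
  `IsQCDAlong ((reindex reg φ).scheme m z shift) T`, non-trivial non-Gaussian glue, every flavour-changing pseudoscalar
  non-trivial, and a continuum gap `T.HasMassGap Δ`, `Δ = Δ(m) > 0` — existence along ONE subsequence serving all
  masses (compactness + mass-equicontinuity), NOT convergence along the given sequence (which would smuggle in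
  uniqueness/universality of the continuum limit).

`ChirallyAnchoredQCDThree_of : Stmt.stub_diagonalLatticeAnchors → Stmt.stub_chiralSoftness →
Stmt.stub_continuumBodyOfPinned → ChirallyAnchoredQCDThree` is kernel-checked: the lattice stub yields `reg`; the
continuum law yields the subsequence `φ` and the continuum body of `reindex reg φ`; leading-log mass scaling, the honest
pin and the diagonal anchors PASS TO THE SUBSEQUENCE (`hasMassScaling_reindex`, `honestlyPinned_reindex`,
`diagonalAnchors_reindex` — Tendsto/Eventually composed with `φ → ∞`, the scheme of the reindexed regularisation being
definitionally the reindexed scheme); the chiral law applied to `reindex reg φ` gives `IsChiralAtZero` THERE (this is why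
the chiral clause is a law and not a conjunct of the lattice stub: `¬ HasLatticeMassGap ε` is not stable under passing to
a subsequence, the pin is); and the crux's CO-INITIAL anchor clause follows from the diagonal anchors by taking
`η_j ≤ min_f m_f` (`coinitial_of_diagonal`: `η_j → 0` and `Fin 3` finite).  `chirallyAnchoredQCDThree_of_stubs`
instantiates it.

## Negative knowledge honoured (read 2026-08-17)
* `Cruxes/ChirallyAnchoredQCDThree/` had NO workfiles before this one (no `Disproof.lean`, no ideas, no dead lines);
  the crux's evidence is the route reviewer's `R5Checks.lean` (rreview1, 2026-08-16: exact content of the socket =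
  QCDOf-3 witness that also carries the fixed-`k` ray certificate, minus the ∀m lattice-gap clause away from the
  anchors; `hasLatticeMassGap_scheme_iff`, `not_qcdOf_zero`).  This skeleton respects that reading: the ray certificate
  and the anchors' gaps sit in the constructive stub S1, the continuum clauses in S3, the no-gap clause in S2.
* `ledger negatives --problem QuantumFields` (the five entries known to the sibling registrars of 2026-08-17:
  RobustYangMillsRG stmt-14958 — a wild blocking map inhabits an under-constrained admissibility predicate;
  MirrorModularBoosts stmt-9665; AdaptiveCoarseSystem stmt-9494; MultibosonLatticeGap stmt-9599 — an unsatisfiable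
  admissibility clause; AdmissibleRootsExist stmt-9603).  Lesson applied: the only hypothesis predicate of the two
  ∀-laws, `HonestlyPinned`, is NOT bespoke — it is the corner/pin/scaling/branch hypothesis list of the vetted shared
  cruxes `EulerDescent.RayDescent/ChiralCornerSoftness/RetypedContinuumComplement`, verbatim; it is not junk-inhabited
  (an empty or total non-massive set has no least upper bound in `ℝ`, so regularisations whose fermionic partition
  functions vanish identically — junk `0` correlators, every gap — or never cluster do not qualify), and a
  threshold-SHIFTED honest regularisation (`m_crit + a_k M₀/Z_m`, the witness-to-witness symmetry killed by p117723,
  probe `shifted_not_chiral`) violates the pin, which is exactly why S2 can be a law.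
* Junk witnesses: the vacuum data with `z ≡ 0` inhabit `IsQCDAlong` (`isQCDAlong_zeroAF_vacuum`) but NOT the
  non-decoupling clause of S3's conclusion; S1 is an ∃-statement whose certificate + gap + pin + chiral-compatible
  corner exclude the degenerate regularisations `zeroAF/canonicalAF` as far as anyone can decide (no automation closes
  it: BC3 probes).
* Typing checklist 4c: no Bochner integral over a free function, no hand-picked threshold or rate (`η_j, Δ⋆_j, Δ, δ, mc`
  existential), no determinantal / complex-action positivity claim (the signed `(det D_W)³` weight enters only the
  volume-uniform constants inside S1/S3, conceded in the crux's why-it-might-fail).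

## BC3 probes (planner folder `bc/`): for each stub statement `S`, `S → ChirallyAnchoredQCDThree` and `S → QCD` by
`first | exact? | simpa | aesop` FAIL (file `bc/probes.lean`, statements copied verbatim with no stub or composition in
scope; rc and goals in the seat's NOTES.md and in `Lines/birth.md`).
-/

noncomputable section

namespace Summit.QuantumFields.QCD.Cruxes.ChirallyAnchoredQCDThree.Birth

open scoped Topology
open Filter
open Literature.MathematicalPhysics.QuantumFieldTheory
open Summit.QuantumFields.QCD.Theses.QuarkMassMonotone

/-! ## §0 Currency (the Statement's vocabulary + the EulerDescent corner pin, verbatim) -/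

/-- **Lattice QCD with `N_f` degenerate Wilson quarks of bare mass `μ` at inverse coupling `β` is MASSIVE**: every pair
of gauge-invariant local lattice observables clusters exponentially at SOME lattice rate, uniformly in the volume (the
set whose complement's supremum is the intrinsic chiral corner; body verbatim from `EulerDescent.RayDescent`). -/
def IsMassiveAt (Nf : ℕ) (β μ : ℝ) : Prop :=
  ∀ (R R' : ℕ) (A : QCDLatticeObservable Nf R) (B : QCDLatticeObservable Nf R'),
    ∃ (C δ : ℝ) (S₀ : ℕ), 0 < δ ∧ ∀ S : ℕ, S₀ ≤ S → ∀ n : ℕ, n ≤ S →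
      ‖qcdLatticeConnectedCorr β (2 * S + 1) (fun _ : Fin Nf => μ) A B n‖ ≤ C * Real.exp (-(δ * n))

/-- **Honestly pinned regularisation** (the "intrinsic pin of `m_crit`" of the route header's two-layer plan, typed as
the hypothesis list of `EulerDescent.RayDescent / ChiralCornerSoftness / RetypedContinuumComplement`): (corner + pin)
for some `mc : ℕ → ℝ`, eventually in `k` the number `mc k` is the least upper bound of the degenerate bare Wilson masses
at which lattice QCD at coupling `β_k` is not massive, and `(reg.mcrit k − mc k) · Z_m(k) / a_k → 0` (the critical mass
is the intrinsic corner up to `o(a_k / Z_m(k))`, i.e. up to `o(1)` in renormalised units — this is what excludes the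
threshold-shifted twins `m_crit + a_k M₀ / Z_m`); (scaling) two-loop asymptotic scaling of `β_k` against `a_k`;
(branch) `reg.mcrit k > −1` eventually (Lüscher positivity range, doublers at the cutoff). -/
def HonestlyPinned {Nf : ℕ} (reg : QCDRegularisation Nf) : Prop :=
  (∃ mc : ℕ → ℝ, (∀ᶠ k in atTop, IsLUB {μ : ℝ | ¬ IsMassiveAt Nf (reg.β k) μ} (mc k)) ∧
      Tendsto (fun k => (reg.mcrit k - mc k) * reg.Zm k / reg.a k) atTop (𝓝 0)) ∧
    (reg.scheme 0 0 0).HasAsymptoticScaling ∧ ∀ᶠ k in atTop, (-1 : ℝ) < reg.mcrit k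

/-- **Physical-branch RAY CERTIFICATE at the tuple `m`** (verbatim the hypothesis of `LatticeGapMonotone` and clause
(i) of the crux): eventually in `k`, for every `t ≥ 0` some `δ > 0` such that every pair of gauge-invariant local
lattice QCD observables has `C, S₀` with `‖⟨A·τ_n B⟩ − ⟨A⟩⟨B⟩‖ ≤ C e^{−δ n}` on all tori `2S+1 ≥ 2S₀+1`, `n ≤ S`, at
coupling `β_k` and bare masses `m_f(k) + t`. -/
def RayCertificate {Nf : ℕ} (reg : QCDRegularisation Nf) (m : Fin Nf → ℝ) : Prop :=
  ∀ᶠ k in atTop, ∀ t : ℝ, 0 ≤ t → ∃ δ : ℝ, 0 < δ ∧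
    ∀ (R R' : ℕ) (A : QCDLatticeObservable Nf R) (B : QCDLatticeObservable Nf R'),
      ∃ (C : ℝ) (S₀ : ℕ), ∀ S : ℕ, S₀ ≤ S → ∀ n : ℕ, n ≤ S →
        ‖qcdLatticeConnectedCorr (reg.β k) (2 * S + 1) (fun f => (reg.scheme m 0 0).mq f k + t) A B n‖ ≤
          C * Real.exp (-(δ * n))

/-- **Certified gapped anchor at `m`**: the ray certificate at `m` and a uniform lattice gap `Δ > 0` in physical units
at the bare trajectory of `m` (clause (i) of the crux at one tuple). -/
def CertifiedAnchor {Nf : ℕ} (reg : QCDRegularisation Nf) (m : Fin Nf → ℝ) : Prop :=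
  RayCertificate reg m ∧ ∃ Δ : ℝ, 0 < Δ ∧ (reg.scheme m 0 0).HasLatticeMassGap Δ

/-- **Diagonal certified gapped anchors**: ONE sequence `η_j > 0`, `η_j → 0`, of DEGENERATE tuples `(η_j, …, η_j)`,
each a certified gapped anchor (the header's "certified gapped degenerate anchors η_j ↓ 0"; their rates `Δ⋆_j → 0` are
forced by the chiral law and allowed, `Δ⋆_j` being bound inside `CertifiedAnchor`). -/
def DiagonalAnchors {Nf : ℕ} (reg : QCDRegularisation Nf) : Prop :=
  ∃ η : ℕ → ℝ, (∀ j, 0 < η j) ∧ Tendsto η atTop (𝓝 0) ∧ ∀ j, CertifiedAnchor reg (fun _ : Fin Nf => η j)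

/-- **Continuum body at the tuple `m`** (verbatim clause (ii) of the crux at one tuple): species renormalisations
`z, shift` and OS data `T` with `IsQCDAlong (reg.scheme m z shift) T`, non-trivial non-Gaussian glue, every
flavour-changing pseudoscalar non-trivial (dynamical quarks), and a continuum mass gap `Δ > 0` of `T`. -/
def ContinuumBodyAt {Nf : ℕ} (reg : QCDRegularisation Nf) (m : Fin Nf → ℝ) : Prop :=
  ∃ (z shift : QCDField Nf → ℕ → ℝ) (T : OSData (QCDField Nf) 4),
    IsQCDAlong (reg.scheme m z shift) T ∧ T.IsNontrivial QCDField.glue ∧ T.IsNonGaussian QCDField.glue ∧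
      (∀ f g : Fin Nf, f ≠ g → T.IsNontrivial (QCDField.pseudoRe f g)) ∧ ∃ Δ : ℝ, 0 < Δ ∧ T.HasMassGap Δ

/-- **Passing to a subsequence of steps**: the regularisation `k ↦ reg (φ k)` along a strictly increasing `φ : ℕ → ℕ`
(same spacings, couplings, volumes, critical masses and `Z_m`, re-indexed). [folklore] -/
def reindex {Nf : ℕ} (reg : QCDRegularisation Nf) (φ : ℕ → ℕ) (hφ : StrictMono φ) : QCDRegularisation Nf where
  a := fun k => reg.a (φ k)
  a_pos := fun k => reg.a_pos (φ k)
  tendsto_a := reg.tendsto_a.comp hφ.tendsto_atTop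
  β := fun k => reg.β (φ k)
  L := fun k => reg.L (φ k)
  tendsto_L := reg.tendsto_L.comp hφ.tendsto_atTop
  mcrit := fun k => reg.mcrit (φ k)
  Zm := fun k => reg.Zm (φ k)
  Zm_pos := fun k => reg.Zm_pos (φ k)

/-! ## §1 The three stub statements (`Stmt.stub_<name>` is the statement of the stub `stub_<name>`) -/

/-- **(S1) Diagonal lattice anchors at the honest corner** (the header's DiagonalLatticeAnchors₃, gapped side;
open-problem).  There is a regularisation of `N_f = 3` lattice QCD with leading-log mass scaling, honestly pinned at
the intrinsic chiral corner (corner as least upper bound of the non-massive degenerate bare masses at `β_k`, pin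
`o(a_k/Z_m(k))`, two-loop asymptotic scaling, `m_crit > −1` eventually), carrying ONE sequence `η_j ↓ 0` of degenerate
certified gapped anchors: at each `(η_j, η_j, η_j)` the physical-branch ray certificate (fixed-`k` volume-uniform
clustering of all gauge-invariant local observables at SOME lattice rate along the whole bare ray above the anchor,
eventually in `k`) and a uniform lattice gap `Δ⋆_j > 0` in physical units.  Why plausibly true: massive degenerate
`N_f = 3` QCD is gapped (`Δ⋆_j ≈ m_π(η_j) ∝ √η_j`), heavier degenerate bare masses at fixed weak coupling stay in the
massive phase up to the quenched corner, and an honest infrared construction tunes `m_crit` to the corner.  Why it might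
fail: it contains the volume-uniform lattice gap of SU(3) + 3 light Wilson quarks along an asymptotically scaling
sequence (invisible to every expansion: `a_kΔ⋆ ~ e^{−1/(2b₀g₀²)}`), fixed-`β_k` clustering along heavy rays is proved only
at strong coupling / small `κ` (Osterwalder–Seiler), the weight `(det D_W)³` is signed near `m_crit`, and the corner's
least-upper-bound form needs the pure-gauge sector at `β_k` to cluster for all heavy masses.  Size: open-problem. -/
def Stmt.stub_diagonalLatticeAnchors : Prop :=
  ∃ reg : QCDRegularisation 3, reg.HasMassScaling ∧ HonestlyPinned reg ∧ DiagonalAnchors reg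

/-- **(S2) Chiral softness of honestly pinned regularisations, `N_f = 3`** (the Goldstone input — a NO-gap law; the
`N_f = 3` instance of the shared crux `EulerDescent.ChiralCornerSoftness`, stmt-QuantumFields-16902; open-problem).
Every honestly pinned `N_f = 3` regularisation with leading-log mass scaling is chiral at zero: for every `ε > 0` some
positive tuple has no uniform lattice gap `ε` (the gap closes as `m → 0⁺`).  Why plausibly true: with the pin the
realised renormalisation-group-invariant masses are `κ m_f` with NO common offset, so the lightest flavoured
pseudoscalar has `m_π² ∝ m` (Gell-Mann–Oakes–Renner) if chiral symmetry breaks, and the theory is gapless at `m = 0` by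
anomaly matching otherwise; in both Sharpe–Singleton scenarios the minimal lattice pion mass is `O(a)` or `0`, vanishing
in physical units along the sequence.  Why it might fail: no OS-level proof of Goldstone gaplessness exists; a
lattice-artefact non-massive degenerate point ABOVE the chiral corner at weak coupling would mis-pin `mc`.
Size: open-problem. -/
def Stmt.stub_chiralSoftness : Prop :=
  ∀ reg : QCDRegularisation 3, reg.HasMassScaling → HonestlyPinned reg → reg.IsChiralAtZero

/-- **(S3) Continuum body of honestly pinned anchored regularisations, along a subsequence, `N_f = 3`** (the header's
ContinuumBodyOfPinned₃; open-problem).  For every honestly pinned `N_f = 3` regularisation with leading-log mass scaling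
and diagonal certified gapped anchors there is a strictly increasing `φ : ℕ → ℕ` such that the re-indexed regularisation
carries, at EVERY positive tuple `m`, species renormalisations `z, shift` and OS data `T` with
`IsQCDAlong ((reindex reg φ).scheme m z shift) T` (two-loop scaling and the physical branch are inherited from the pin;
the content is the convergence of all lattice `n`-point functions of the renormalised composite fields along the
subsequence, for all masses at once), non-trivial and non-Gaussian glue, every flavour-changing pseudoscalar
non-trivial, and a continuum mass gap `Δ(m) > 0` of `T`.  Why plausibly true: uniform `E0′` bounds give compactness of
the lattice Schwinger functions, the Feynman–Hellmann identity bounds their mass derivatives so ONE diagonal subsequence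
serves all `m` (Arzelà–Ascoli in the quark mass), rotation invariance is restored along asymptotically scaling
sequences, and massive `N_f = 3` QCD is non-trivial with propagating flavours and a gap `≈ min(m_π, glueball)`.  Why it
might fail: UV stability with LIGHT dynamical Wilson quarks (off-diagonal `E0′` bounds, `E1` restoration,
mass-equicontinuity down to `m → 0⁺`) is proved for no 4d gauge theory; the continuum gap near the chiral corner must
come with `m`-dependent constants only.  Size: open-problem. -/
def Stmt.stub_continuumBodyOfPinned : Prop :=
  ∀ reg : QCDRegularisation 3, reg.HasMassScaling → HonestlyPinned reg → DiagonalAnchors reg →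
    ∃ (φ : ℕ → ℕ) (hφ : StrictMono φ), ∀ m : Fin 3 → ℝ, (∀ f, 0 < m f) → ContinuumBodyAt (reindex reg φ hφ) m

/-! ## §2 The registered stubs (the ONLY `sorry`s of this file) -/

/-- (S1) diagonal certified gapped anchors at the honest corner — open-problem. -/
theorem stub_diagonalLatticeAnchors : Stmt.stub_diagonalLatticeAnchors := by
  sorry

/-- (S2) chiral softness of honestly pinned regularisations — open-problem (Goldstone input). -/
theorem stub_chiralSoftness : Stmt.stub_chiralSoftness := by
  sorry

/-- (S3) continuum body along a subsequence — open-problem. -/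
theorem stub_continuumBodyOfPinned : Stmt.stub_continuumBodyOfPinned := by
  sorry

/-! ## §3 Composition (kernel-checked; no `sorry` below this line) -/

section Reindex

variable {Nf : ℕ} {reg : QCDRegularisation Nf} {φ : ℕ → ℕ} {hφ : StrictMono φ}

/-- Leading-log mass scaling passes to subsequences (the scheme of the re-indexed regularisation is definitionally the
re-indexed scheme: `((reindex reg φ hφ).scheme m z shift).mq f k = (reg.scheme m z shift).mq f (φ k)` by `rfl`). [folklore] -/
theorem hasMassScaling_reindex (h : reg.HasMassScaling) : (reindex reg φ hφ).HasMassScaling := by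
  obtain ⟨c, hc, ht⟩ := h
  exact ⟨c, hc, ht.comp hφ.tendsto_atTop⟩

/-- Two-loop asymptotic scaling passes to subsequences. [folklore] -/
theorem hasAsymptoticScaling_reindex (h : (reg.scheme 0 0 0).HasAsymptoticScaling) :
    ((reindex reg φ hφ).scheme 0 0 0).HasAsymptoticScaling := by
  obtain ⟨Λ, hΛ, ht⟩ := h
  exact ⟨Λ, hΛ, ht.comp hφ.tendsto_atTop⟩

/-- The honest pin passes to subsequences (corner, pin, scaling and branch are Tendsto/Eventually clauses). [folklore] -/
theorem honestlyPinned_reindex (h : HonestlyPinned reg) : HonestlyPinned (reindex reg φ hφ) := by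
  obtain ⟨⟨mc, hlub, hpin⟩, haf, hbr⟩ := h
  exact ⟨⟨fun k => mc (φ k), hφ.tendsto_atTop.eventually hlub, hpin.comp hφ.tendsto_atTop⟩,
    hasAsymptoticScaling_reindex haf, hφ.tendsto_atTop.eventually hbr⟩

/-- A uniform lattice gap passes to subsequences (same rate, same constants). [folklore] -/
theorem hasLatticeMassGap_reindex {m : Fin Nf → ℝ} {Δ : ℝ} (h : (reg.scheme m 0 0).HasLatticeMassGap Δ) :
    ((reindex reg φ hφ).scheme m 0 0).HasLatticeMassGap Δ := by
  intro R R' A B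
  obtain ⟨C, hC⟩ := h R R' A B
  refine ⟨C, (hφ.tendsto_atTop.eventually hC).mono fun k hk => ?_⟩
  intro S hS n hn
  exact hk S hS n hn

/-- The ray certificate passes to subsequences. [folklore] -/
theorem rayCertificate_reindex {m : Fin Nf → ℝ} (h : RayCertificate reg m) : RayCertificate (reindex reg φ hφ) m :=
  (hφ.tendsto_atTop.eventually h).mono fun _ hk => hk

/-- Diagonal certified gapped anchors pass to subsequences. [folklore] -/
theorem diagonalAnchors_reindex (h : DiagonalAnchors reg) : DiagonalAnchors (reindex reg φ hφ) := by
  obtain ⟨η, hpos, hlim, hanch⟩ := h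
  refine ⟨η, hpos, hlim, fun j => ?_⟩
  obtain ⟨hray, Δ, hΔ, hgap⟩ := hanch j
  exact ⟨rayCertificate_reindex hray, Δ, hΔ, hasLatticeMassGap_reindex hgap⟩

end Reindex

/-- **Co-initial anchors from diagonal anchors**: below every positive tuple `m` sits a degenerate anchor
`(η_j, …, η_j)` with `η_j ≤ min_f m_f` (`η_j → 0`, finitely many flavours) — the crux's clause (i). [folklore] -/
theorem coinitial_of_diagonal {Nf : ℕ} {reg : QCDRegularisation Nf} (h : DiagonalAnchors reg) :
    ∀ m : Fin Nf → ℝ, (∀ f, 0 < m f) → ∃ mstar : Fin Nf → ℝ, (∀ f, 0 < mstar f ∧ mstar f ≤ m f) ∧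
      RayCertificate reg mstar ∧ ∃ Δ : ℝ, 0 < Δ ∧ (reg.scheme mstar 0 0).HasLatticeMassGap Δ := by
  intro m hm
  obtain ⟨η, hpos, hlim, hanch⟩ := h
  have hev : ∀ᶠ j in atTop, ∀ f, η j ≤ m f :=
    eventually_all.2 fun f => hlim.eventually (eventually_le_nhds (hm f))
  obtain ⟨j, hj⟩ := hev.exists
  obtain ⟨hray, Δ, hΔ, hgap⟩ := hanch j
  exact ⟨fun _ => η j, fun f => ⟨hpos j, hj f⟩, hray, Δ, hΔ, hgap⟩

/-- **The crux from the three stubs** (concludes `ChirallyAnchoredQCDThree` BY NAME).  The lattice stub gives `reg`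
with mass scaling, the honest pin and diagonal anchors; the continuum law gives a subsequence `φ` and the continuum
body of `reindex reg φ` at every positive tuple; mass scaling, pin and anchors pass to the subsequence; the chiral law
applied THERE gives `IsChiralAtZero`; the co-initial anchor clause is `coinitial_of_diagonal`. -/
theorem ChirallyAnchoredQCDThree_of :
    Stmt.stub_diagonalLatticeAnchors → Stmt.stub_chiralSoftness → Stmt.stub_continuumBodyOfPinned →
      ChirallyAnchoredQCDThree := by
  intro hL hC hK
  obtain ⟨reg, hms, hpin, hanch⟩ := hL
  obtain ⟨φ, hφ, hbody⟩ := hK reg hms hpin hanch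
  have hms' : (reindex reg φ hφ).HasMassScaling := hasMassScaling_reindex hms
  have hpin' : HonestlyPinned (reindex reg φ hφ) := honestlyPinned_reindex hpin
  have hanch' : DiagonalAnchors (reindex reg φ hφ) := diagonalAnchors_reindex hanch
  exact ⟨reindex reg φ hφ, hms', hC _ hms' hpin', coinitial_of_diagonal hanch', hbody⟩

/-- The crux along this skeleton, from the registered stubs (sorries only inside `stub_*`). -/
theorem chirallyAnchoredQCDThree_of_stubs : ChirallyAnchoredQCDThree :=
  ChirallyAnchoredQCDThree_of stub_diagonalLatticeAnchors stub_chiralSoftness stub_continuumBodyOfPinned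

end Summit.QuantumFields.QCD.Cruxes.ChirallyAnchoredQCDThree.Birth

end
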